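import Literature.Analysis.FluidPDE.OnsagerBDSVGluing
import Literature.Analysis.FunctionSpaces.ContDiffHolderLeibniz
import Literature.Analysis.FunctionSpaces.ContDiffHolderAlgebra
import HarnessLib

/-!
# The BDSV perturbation: scale-graded `C^N` bounds `‖f‖_N ≲ A ℓ^{-N}` and their algebra

Buckmaster–De Lellis–Székelyhidi–Vicol (BDSV), *Onsager's conjecture for admissible weak
solutions*, CPAM 72 (2019) = arXiv:1701.08678, §5.5: every estimate of Props. 5.7 and 5.9
(arXiv (5.23)–(5.26), (5.37)–(5.39)) has the shape "`‖f‖_N ≲ A ℓ^{-N}` for all `N ≥ 0`" — each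
spatial derivative costs one power of the mollification length `ℓ` — and the proofs combine such
bounds through the product rule (App. A (A.2)), e.g. (proof of Prop. 5.7)
"`‖R̃_{q,i}‖_N ≲ ‖∇Φ_i‖_N ‖∇Φ_i‖₀ + ‖R_{q,i}/ρ_{q,i}‖_N`", (proof of Prop. 5.9)
"`‖D_{t,q}∇Φ_i‖_N ≲ ‖∇Φ_i‖₀‖v̄_q‖_{N+1} + ‖∇Φ_i‖_N‖v̄_q‖₁`". This file isolates that bookkeeping
once and for all for time-dependent fields on `T³`, in the vocabulary of the tree
(`BDSV.HolderSupOnLE`, the accepted `C^{N,0}` norms `Torus.eContDiffHolderNorm N 0`):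

* `BDSV.GradedSupLE J f N A ℓ`: `‖f(t)‖_{j,0} ≤ A ℓ^{-j}` for all `t ∈ J` and all `j ≤ N`;
* its algebra: monotonicity, constants, sums, differences, continuous linear images, time-only
  scalar factors, the derivative shift `‖∇f‖_j ≤ ‖f‖_{j+1}`, passage from a positive Hölder
  exponent (`‖·‖_{j,0} ≤ 3‖·‖_{j,r}`), and the **graded Leibniz rule**
  `BDSV.GradedSupLE.bilinear`: graded bounds `A`, `B'` for `f`, `g` give the graded bound
  `3ᴺ (N+1) ‖B‖ A B'` for `B(f,g)`, `B` continuous bilinear (from the accepted Leibniz estimate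
  `Torus.eContDiffHolderNorm_bilinear_le`, `∑_{i ≤ j} ℓ^{-i} ℓ^{-(j-i)} = (j+1) ℓ^{-j}`).

## References

* T. Buckmaster, C. De Lellis, L. Székelyhidi Jr., V. Vicol, *Onsager's conjecture for admissible
  weak solutions*, Comm. Pure Appl. Math. 72 (2019) 229–274 = arXiv:1701.08678, §5.5
  (Props. 5.7, 5.9 and their proofs), App. A (A.2).
-/

open Set
open scoped NNReal ENNReal ContDiff

noncomputable section

namespace Literature.Analysis.FluidPDE

namespace BDSV

open FunctionSpaces FunctionSpaces.Torus

/-- The flat three-torus `T³ = (ℝ/ℤ)³`, local notation. -/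
local notation "𝕋³" => UnitAddTorus (Fin 3)

/-! ## The graded bound -/

section Graded

variable {Y : Type*} [NormedAddCommGroup Y] [NormedSpace ℝ Y]

/-- **Scale-graded `C^N` bounds** (the shape of the estimates of BDSV Props. 5.7 and 5.9,
"`‖f‖_N ≲ ℓ^{-N}` for any `N ≥ 0`"): for every `t ∈ J` and every `j ≤ N`, the spatial `C^{j,0}`
norm of the slice `f(t)` is at most `A ℓ^{-j}` (`BDSV.HolderSupOnLE J f j 0 (A ℓ^{-j})`).
[cite: BuckmasterEtAl2018, Prop. 5.7 (shape of arXiv (5.23)–(5.26))] -/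
def GradedSupLE (J : Set ℝ) (f : ℝ → 𝕋³ → Y) (N : ℕ) (A ℓ : ℝ) : Prop :=
  ∀ j : ℕ, j ≤ N → HolderSupOnLE J f j 0 (A * ℓ ^ (-(j : ℝ)))

variable {J J' : Set ℝ} {f g : ℝ → 𝕋³ → Y} {N M : ℕ} {A A' ℓ : ℝ}

/-- Unfolding `GradedSupLE` at one time and one order. [folklore] -/
theorem GradedSupLE.le (h : GradedSupLE J f N A ℓ) {t : ℝ} (ht : t ∈ J) {j : ℕ} (hj : j ≤ N) :
    Torus.eContDiffHolderNorm j 0 (f t) ≤ ENNReal.ofReal (A * ℓ ^ (-(j : ℝ))) :=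
  h j hj t ht

/-- The top order of a graded bound. [folklore] -/
theorem GradedSupLE.holderSupOnLE (h : GradedSupLE J f N A ℓ) :
    HolderSupOnLE J f N 0 (A * ℓ ^ (-(N : ℝ))) :=
  h N le_rfl

/-- The order-zero part of a graded bound: `‖f(t)‖_{0,0} ≤ A`. [folklore] -/
theorem GradedSupLE.zero (h : GradedSupLE J f N A ℓ) : HolderSupOnLE J f 0 0 A := by
  have h0 := h 0 (Nat.zero_le N)
  simpa using h0

/-- Pointwise values under a graded bound: `‖f(t,x)‖ ≤ A` (for `A ≥ 0`). [folklore] -/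
theorem GradedSupLE.norm_le (h : GradedSupLE J f N A ℓ) (hA : 0 ≤ A) {t : ℝ} (ht : t ∈ J)
    (x : 𝕋³) : ‖f t x‖ ≤ A := by
  have h1 := (Torus.enorm_le_eContDiffHolderNorm 0 0 (f t) x).trans (h.zero t ht)
  rwa [← ofReal_norm, ENNReal.ofReal_le_ofReal_iff hA] at h1

/-- Monotonicity in the constant (`ℓ > 0`). [folklore] -/
theorem GradedSupLE.mono (h : GradedSupLE J f N A ℓ) (hℓ : 0 < ℓ) (hA : A ≤ A') :
    GradedSupLE J f N A' ℓ :=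
  fun j hj => (h j hj).mono (mul_le_mul_of_nonneg_right hA (Real.rpow_nonneg hℓ.le _))

/-- Monotonicity in the order. [folklore] -/
theorem GradedSupLE.of_le (h : GradedSupLE J f N A ℓ) (hMN : M ≤ N) : GradedSupLE J f M A ℓ :=
  fun j hj => h j (hj.trans hMN)

/-- Monotonicity in the time set. [folklore] -/
theorem GradedSupLE.anti (h : GradedSupLE J f N A ℓ) (hJ : J' ⊆ J) : GradedSupLE J' f N A ℓ :=
  fun j hj => (h j hj).anti hJ

/-- A graded bound only depends on the values of the field on `J × T³`. [folklore] -/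
theorem GradedSupLE.congr (h : GradedSupLE J f N A ℓ) (hfg : ∀ t ∈ J, ∀ x, f t x = g t x) :
    GradedSupLE J g N A ℓ := by
  intro j hj t ht
  have e : g t = f t := funext fun x => (hfg t ht x).symm
  rw [e]
  exact h.le ht hj

/-- For `0 < ℓ ≤ 1` the weights `ℓ^{-j}` are at least `1`. [folklore] -/
theorem one_le_rpow_neg_nat (hℓ : 0 < ℓ) (hℓ1 : ℓ ≤ 1) (j : ℕ) : (1 : ℝ) ≤ ℓ ^ (-(j : ℝ)) :=
  Real.one_le_rpow_of_pos_of_le_one_of_nonpos hℓ hℓ1 (by simp)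

/-- `ℓ^{-i} ℓ^{-k} = ℓ^{-(i+k)}`. [folklore] -/
theorem rpow_neg_nat_mul (hℓ : 0 < ℓ) (i k : ℕ) :
    ℓ ^ (-(i : ℝ)) * ℓ ^ (-(k : ℝ)) = ℓ ^ (-((i + k : ℕ) : ℝ)) := by
  rw [← Real.rpow_add hℓ]
  congr 1
  push_cast
  ring

/-- The `C^{k,r}` norm of a constant map on `T³` is at most the norm of the constant (a private
specialisation, at `d = Fin 3`, of `BDSV.eContDiffHolderNorm_const_le` of
`OnsagerBDSVDeformationBoundsProofs.lean`, whose import closure is not wanted here). [folklore] -/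
private theorem eContDiffHolderNorm_const_le₃ (k : ℕ) (r : ℝ≥0) (c : Y) :
    Torus.eContDiffHolderNorm k r (fun _ : 𝕋³ => c) ≤ ‖c‖ₑ := by
  unfold Torus.eContDiffHolderNorm FunctionSpaces.eContDiffHolderNorm
  have hlift : lift (fun _ : 𝕋³ => c) = fun _ : EuclideanSpace ℝ (Fin 3) => c := rfl
  rw [hlift]
  have hD : ∀ j : ℕ, j ≠ 0 →
      iteratedFDeriv ℝ j (fun _ : EuclideanSpace ℝ (Fin 3) => c) = 0 := fun j hj =>
    iteratedFDeriv_const_of_ne hj c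
  have hsup0 : eSupNorm (iteratedFDeriv ℝ 0 (fun _ : EuclideanSpace ℝ (Fin 3) => c)) ≤ ‖c‖ₑ := by
    rw [eSupNorm_iteratedFDeriv_zero]
    exact iSup_le fun _ => le_rfl
  have hsum : ∑ j ∈ Finset.range (k + 1),
      eSupNorm (iteratedFDeriv ℝ j (fun _ : EuclideanSpace ℝ (Fin 3) => c)) ≤ ‖c‖ₑ := by
    rw [Finset.sum_range_succ']
    have hz : ∑ j ∈ Finset.range k,
        eSupNorm (iteratedFDeriv ℝ (j + 1) (fun _ : EuclideanSpace ℝ (Fin 3) => c)) = 0 :=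
      Finset.sum_eq_zero fun j _ => by rw [hD (j + 1) (Nat.succ_ne_zero j), eSupNorm_zero]
    rw [hz, zero_add]
    exact hsup0
  have hconst : ∃ m : EuclideanSpace ℝ (Fin 3) [×k]→L[ℝ] Y,
      iteratedFDeriv ℝ k (fun _ : EuclideanSpace ℝ (Fin 3) => c) = fun _ => m := by
    rcases Nat.eq_zero_or_pos k with rfl | hk
    · exact ⟨(continuousMultilinearCurryFin0 ℝ (EuclideanSpace ℝ (Fin 3)) Y).symm c, by
        rw [iteratedFDeriv_zero_eq_comp]; rfl⟩
    · exact ⟨0, by rw [hD k hk.ne']; rfl⟩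
  have hhol : eHolderNorm r (iteratedFDeriv ℝ k (fun _ : EuclideanSpace ℝ (Fin 3) => c)) = 0 := by
    obtain ⟨m, hm⟩ := hconst
    rw [hm]
    exact eHolderNorm_const (X := EuclideanSpace ℝ (Fin 3)) r m
  rw [hhol, add_zero]
  exact hsum

/-- **Constants**: a constant field has the graded bound `‖c‖` (for `0 < ℓ ≤ 1`). [folklore] -/
theorem gradedSupLE_const (J : Set ℝ) (N : ℕ) (c : Y) (hℓ : 0 < ℓ) (hℓ1 : ℓ ≤ 1) :
    GradedSupLE J (fun (_ : ℝ) (_ : 𝕋³) => c) N ‖c‖ ℓ := by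
  intro j _ t _
  refine (eContDiffHolderNorm_const_le₃ j 0 c).trans ?_
  rw [← ofReal_norm]
  exact ENNReal.ofReal_le_ofReal (le_mul_of_one_le_right (norm_nonneg c)
    (one_le_rpow_neg_nat hℓ hℓ1 j))

/-- **Sums** of graded fields (smooth slices). [folklore] -/
theorem GradedSupLE.add {B : ℝ} (hf : GradedSupLE J f N A ℓ) (hg : GradedSupLE J g N B ℓ)
    (hfs : ∀ t ∈ J, IsSmooth (f t)) (hgs : ∀ t ∈ J, IsSmooth (g t)) (hA : 0 ≤ A) (hB : 0 ≤ B)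
    (hℓ : 0 < ℓ) : GradedSupLE J (fun t x => f t x + g t x) N (A + B) ℓ := by
  intro j hj t ht
  have h1 : IsContDiff j (f t) := (hfs t ht).isContDiff (by exact_mod_cast le_top)
  have h2 : IsContDiff j (g t) := (hgs t ht).isContDiff (by exact_mod_cast le_top)
  show Torus.eContDiffHolderNorm j 0 (f t + g t) ≤ _
  refine (Torus.eContDiffHolderNorm_add_le h1 h2).trans ?_
  rw [add_mul, ENNReal.ofReal_add (mul_nonneg hA (Real.rpow_nonneg hℓ.le _))
    (mul_nonneg hB (Real.rpow_nonneg hℓ.le _))]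
  exact add_le_add (hf.le ht hj) (hg.le ht hj)

/-- **Negation** of a graded field. [folklore] -/
theorem GradedSupLE.neg (hf : GradedSupLE J f N A ℓ) : GradedSupLE J (fun t x => -f t x) N A ℓ := by
  intro j hj t ht
  show Torus.eContDiffHolderNorm j 0 (-f t) ≤ _
  rw [Torus.eContDiffHolderNorm_neg]
  exact hf.le ht hj

/-- **Differences** of graded fields (smooth slices). [folklore] -/
theorem GradedSupLE.sub {B : ℝ} (hf : GradedSupLE J f N A ℓ) (hg : GradedSupLE J g N B ℓ)
    (hfs : ∀ t ∈ J, IsSmooth (f t)) (hgs : ∀ t ∈ J, IsSmooth (g t)) (hA : 0 ≤ A) (hB : 0 ≤ B)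
    (hℓ : 0 < ℓ) : GradedSupLE J (fun t x => f t x - g t x) N (A + B) ℓ := by
  have h := hf.add hg.neg hfs (fun t ht => (hgs t ht).neg) hA hB hℓ
  simpa [sub_eq_add_neg] using h

/-- **Continuous linear images** of a graded field: `‖L ∘ f‖_j ≤ ‖L‖ ‖f‖_j`. [folklore] -/
theorem GradedSupLE.clm {Z : Type*} [NormedAddCommGroup Z] [NormedSpace ℝ Z]
    (hf : GradedSupLE J f N A ℓ) (hfs : ∀ t ∈ J, IsSmooth (f t)) (L : Y →L[ℝ] Z) :
    GradedSupLE J (fun t x => L (f t x)) N (‖L‖ * A) ℓ := by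
  intro j hj t ht
  have h1 : IsContDiff j (f t) := (hfs t ht).isContDiff (by exact_mod_cast le_top)
  refine (Torus.eContDiffHolderNorm_clm_comp_le L h1 0).trans ?_
  rw [mul_assoc, ENNReal.ofReal_mul (norm_nonneg _), ofReal_norm]
  exact mul_le_mul' le_rfl (hf.le ht hj)

/-- **Time-only scalar factors**: if `|θ(t)| ≤ m` on `J` then `θ(t) f(t,x)` has the graded bound
`m A`. [folklore] -/
theorem GradedSupLE.time_smul {θ : ℝ → ℝ} {m : ℝ} (hf : GradedSupLE J f N A ℓ)
    (hfs : ∀ t ∈ J, IsSmooth (f t)) (hθ : ∀ t ∈ J, |θ t| ≤ m) :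
    GradedSupLE J (fun t x => θ t • f t x) N (m * A) ℓ := by
  intro j hj t ht
  have h1 : IsContDiff j (f t) := (hfs t ht).isContDiff (by exact_mod_cast le_top)
  show Torus.eContDiffHolderNorm j 0 (θ t • f t) ≤ _
  rw [Torus.eContDiffHolderNorm_const_smul h1, mul_assoc,
    ENNReal.ofReal_mul ((abs_nonneg _).trans (hθ t ht)), ← ofReal_norm, Real.norm_eq_abs]
  exact mul_le_mul' (ENNReal.ofReal_le_ofReal (hθ t ht)) (hf.le ht hj)

/-- **From a positive Hölder exponent**: bounds `‖f(t)‖_{j,r} ≤ A ℓ^{-j}`, `j ≤ N`, give the graded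
bound `3A` (`‖·‖_{j,0} ≤ 3‖·‖_{j,r}`, the `0`-seminorm being the oscillation). [folklore] -/
theorem gradedSupLE_of_holder {r : ℝ≥0}
    (h : ∀ j : ℕ, j ≤ N → HolderSupOnLE J f j r (A * ℓ ^ (-(j : ℝ)))) :
    GradedSupLE J f N (3 * A) ℓ := by
  intro j hj t ht
  refine (Torus.eContDiffHolderNorm_exponent_zero_le j r (f t)).trans ?_
  rw [mul_assoc, ENNReal.ofReal_mul zero_le_three, ENNReal.ofReal_ofNat]
  exact mul_le_mul' le_rfl (h j hj t ht)

/-- **Derivative shift**: bounds `‖f(t)‖_{j+1,0} ≤ A ℓ^{-j}` for `j ≤ N` give the graded bound `A`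
for the field of spatial derivatives `∇f(t) = Torus.fderiv (f t)` (`‖∇f‖_j ≤ ‖f‖_{j+1}`). [folklore] -/
theorem gradedSupLE_fderiv_of_succ
    (h : ∀ j : ℕ, j ≤ N → HolderSupOnLE J f (j + 1) 0 (A * ℓ ^ (-(j : ℝ)))) :
    GradedSupLE J (fun t x => Torus.fderiv (f t) x) N A ℓ :=
  fun j hj t ht => (Torus.eContDiffHolderNorm_fderiv_le j 0 (f t)).trans (h j hj t ht)

/-- **Derivative shift within a graded bound**: a graded bound `A` up to order `N + 1` gives the
graded bound `A ℓ⁻¹` up to order `N` for the spatial derivative (`ℓ^{-(j+1)} = ℓ⁻¹ ℓ^{-j}`). [folklore] -/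
theorem GradedSupLE.fderiv (h : GradedSupLE J f (N + 1) A ℓ) (hℓ : 0 < ℓ) :
    GradedSupLE J (fun t x => Torus.fderiv (f t) x) N (A * ℓ⁻¹) ℓ := by
  refine gradedSupLE_fderiv_of_succ fun j hj t ht => ?_
  have h1 := h.le ht (Nat.succ_le_succ hj)
  have e : A * ℓ ^ (-((j + 1 : ℕ) : ℝ)) = A * ℓ⁻¹ * ℓ ^ (-(j : ℝ)) := by
    rw [mul_assoc, ← Real.rpow_neg_one, ← Real.rpow_add hℓ]
    congr 2
    push_cast
    ring
  rwa [e] at h1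

end Graded

/-! ## The graded Leibniz rule -/

section Leibniz

variable {Y₁ Y₂ Z : Type} [NormedAddCommGroup Y₁] [NormedSpace ℝ Y₁]
  [NormedAddCommGroup Y₂] [NormedSpace ℝ Y₂] [NormedAddCommGroup Z] [NormedSpace ℝ Z]
variable {J : Set ℝ} {f : ℝ → 𝕋³ → Y₁} {g : ℝ → 𝕋³ → Y₂} {N : ℕ} {A B' ℓ : ℝ}

/-- The sum `∑_{i ≤ j} (A ℓ^{-i})(B' ℓ^{-(j-i)}) = (j+1) A B' ℓ^{-j}` behind the graded Leibniz
rule, as an inequality in `ℝ≥0∞`. [folklore] -/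
theorem sum_ofReal_rpow_neg_le (hA : 0 ≤ A) (hB : 0 ≤ B') (hℓ : 0 < ℓ) (j : ℕ) :
    ∑ i ∈ Finset.range (j + 1),
        ENNReal.ofReal (A * ℓ ^ (-(i : ℝ))) * ENNReal.ofReal (B' * ℓ ^ (-((j - i : ℕ) : ℝ))) ≤
      ENNReal.ofReal ((j + 1) * (A * B' * ℓ ^ (-(j : ℝ)))) := by
  have hterm : ∀ i ∈ Finset.range (j + 1),
      ENNReal.ofReal (A * ℓ ^ (-(i : ℝ))) * ENNReal.ofReal (B' * ℓ ^ (-((j - i : ℕ) : ℝ))) =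
        ENNReal.ofReal (A * B' * ℓ ^ (-(j : ℝ))) := by
    intro i hi
    have hij : i ≤ j := Nat.lt_succ_iff.1 (Finset.mem_range.1 hi)
    rw [← ENNReal.ofReal_mul (mul_nonneg hA (Real.rpow_nonneg hℓ.le _))]
    congr 1
    calc A * ℓ ^ (-(i : ℝ)) * (B' * ℓ ^ (-((j - i : ℕ) : ℝ)))
        = A * B' * (ℓ ^ (-(i : ℝ)) * ℓ ^ (-((j - i : ℕ) : ℝ))) := by ring
      _ = A * B' * ℓ ^ (-(j : ℝ)) := by rw [rpow_neg_nat_mul hℓ, Nat.add_sub_cancel' hij]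
  rw [Finset.sum_congr rfl hterm, Finset.sum_const, Finset.card_range, nsmul_eq_mul]
  have h0 : 0 ≤ A * B' * ℓ ^ (-(j : ℝ)) := mul_nonneg (mul_nonneg hA hB) (Real.rpow_nonneg hℓ.le _)
  refine le_of_eq ?_
  calc ((j + 1 : ℕ) : ℝ≥0∞) * ENNReal.ofReal (A * B' * ℓ ^ (-(j : ℝ)))
      = ENNReal.ofReal ((j + 1 : ℕ) : ℝ) * ENNReal.ofReal (A * B' * ℓ ^ (-(j : ℝ))) := by
        rw [ENNReal.ofReal_natCast]
    _ = ENNReal.ofReal (((j + 1 : ℕ) : ℝ) * (A * B' * ℓ ^ (-(j : ℝ)))) :=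
        (ENNReal.ofReal_mul (Nat.cast_nonneg _)).symm
    _ = ENNReal.ofReal ((j + 1) * (A * B' * ℓ ^ (-(j : ℝ)))) := by push_cast; rfl

/-- **The graded Leibniz rule** (BDSV App. A (A.2) in the bookkeeping of §5.5): if `f` and `g`
have graded bounds `A` and `B'` up to order `N` on `J` (smooth slices), then for every continuous
bilinear `B` the field `B(f,g)` has the graded bound `3ᴺ (N+1) ‖B‖ A B'`:
`‖B(f,g)(t)‖_j ≤ 3ʲ‖B‖ ∑_{i≤j} ‖f‖_i ‖g‖_{j-i} ≤ 3ʲ‖B‖ (j+1) A B' ℓ^{-j}`.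
[cite: BuckmasterEtAl2018, App. A (A.2)] -/
theorem GradedSupLE.bilinear (B : Y₁ →L[ℝ] Y₂ →L[ℝ] Z) (hf : GradedSupLE J f N A ℓ)
    (hg : GradedSupLE J g N B' ℓ) (hfs : ∀ t ∈ J, IsSmooth (f t)) (hgs : ∀ t ∈ J, IsSmooth (g t))
    (hA : 0 ≤ A) (hB : 0 ≤ B') (hℓ : 0 < ℓ) :
    GradedSupLE J (fun t x => B (f t x) (g t x)) N (3 ^ N * (N + 1) * ‖B‖ * A * B') ℓ := by
  intro j hj t ht
  have h1 : IsContDiff j (f t) := (hfs t ht).isContDiff (by exact_mod_cast le_top)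
  have h2 : IsContDiff j (g t) := (hgs t ht).isContDiff (by exact_mod_cast le_top)
  refine (Torus.eContDiffHolderNorm_bilinear_le B h1 h2 0).trans ?_
  have hsum : ∑ i ∈ Finset.range (j + 1),
      Torus.eContDiffHolderNorm i 0 (f t) * Torus.eContDiffHolderNorm (j - i) 0 (g t) ≤
      ENNReal.ofReal ((j + 1) * (A * B' * ℓ ^ (-(j : ℝ)))) := by
    refine le_trans (Finset.sum_le_sum fun i hi => ?_) (sum_ofReal_rpow_neg_le hA hB hℓ j)
    have hij : i ≤ j := Nat.lt_succ_iff.1 (Finset.mem_range.1 hi)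
    exact mul_le_mul' (hf.le ht (hij.trans hj)) (hg.le ht ((Nat.sub_le j i).trans hj))
  calc 3 ^ j * ‖B‖ₑ * ∑ i ∈ Finset.range (j + 1),
          Torus.eContDiffHolderNorm i 0 (f t) * Torus.eContDiffHolderNorm (j - i) 0 (g t)
      ≤ 3 ^ j * ‖B‖ₑ * ENNReal.ofReal ((j + 1) * (A * B' * ℓ ^ (-(j : ℝ)))) :=
        mul_le_mul' le_rfl hsum
    _ = ENNReal.ofReal (3 ^ j * (j + 1) * ‖B‖ * A * B' * ℓ ^ (-(j : ℝ))) := by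
        rw [← ofReal_norm, ← ENNReal.ofReal_ofNat 3, ← ENNReal.ofReal_pow (by norm_num),
          ← ENNReal.ofReal_mul (by positivity), ← ENNReal.ofReal_mul (by positivity)]
        congr 1
        ring
    _ ≤ ENNReal.ofReal (3 ^ N * (N + 1) * ‖B‖ * A * B' * ℓ ^ (-(j : ℝ))) := by
        refine ENNReal.ofReal_le_ofReal ?_
        have hj' : (j : ℝ) + 1 ≤ N + 1 := by exact_mod_cast Nat.succ_le_succ hj
        have h3 : (3 : ℝ) ^ j ≤ 3 ^ N := pow_le_pow_right₀ (by norm_num) hj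
        have hrest : 0 ≤ ‖B‖ * A * B' * ℓ ^ (-(j : ℝ)) :=
          mul_nonneg (mul_nonneg (mul_nonneg (norm_nonneg B) hA) hB) (Real.rpow_nonneg hℓ.le _)
        calc (3 : ℝ) ^ j * (j + 1) * ‖B‖ * A * B' * ℓ ^ (-(j : ℝ))
            = (3 ^ j * (j + 1)) * (‖B‖ * A * B' * ℓ ^ (-(j : ℝ))) := by ring
          _ ≤ (3 ^ N * (N + 1)) * (‖B‖ * A * B' * ℓ ^ (-(j : ℝ))) := by
              refine mul_le_mul_of_nonneg_right ?_ hrest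
              exact mul_le_mul h3 hj' (by positivity) (by positivity)
          _ = 3 ^ N * (N + 1) * ‖B‖ * A * B' * ℓ ^ (-(j : ℝ)) := by ring

end Leibniz

end BDSV

end Literature.Analysis.FluidPDE
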